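import Literature.Probability.LatticeModels.RandomClusterRimWiringOutside
import Literature.Probability.Percolation.BlockExplorationBasic
import HarnessLib

/-!
# Kesten's kernel on a scale frame: the Markov steps at an off-wired datum (proved)

Topic `Literature/Probability/LatticeModels` (trunk `StatMech`, family `crit-ising`). The two
probabilistic identities at an exploration datum used in the cross-ratio bound of the chain kernel
of Kesten's ratio-limit scheme (H. Kesten, PTRF 73 (1986), §2, Lemma (23); D. Basu, A. Sapozhnikov,
ECP 22 (2017), §2, eq. (2.9)), for the finite-graph random-cluster measure `rcMeasure G p q B` and
the exploration data of `BlockExploration*.lean`, with the datum event of `(S, Rv)` read on the set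
`T` of `G`-edges touching the explored set `S` and its rim WIRED OFF THE INSIDE `In`:
`Fd = {ω | ω ∩ T ∈ explEvent In Blk S Rv ∩ {rim wired through S ∖ In}}`.

* `datumOffT_rimHyps` — `Fd` is determined on `T`, its open `T`-edges leave `S` only into `Rv`, and
  `Rv` is joined through open `T`-edges: the hypotheses of the rim-wiring Markov property
  (`RandomClusterRimWiringOutside.lean`);
* `rcMeasure_real_datumOffT_two_block_bounds` — (M4 at the datum) for an inside event `A` (read on
  `T`) and an outside event `C` (read off `T`), with the ambient wired set `B` off `S`:
  `φ(Fd ∩ A ∩ C) ≤ q φ(Fd ∩ A) ν(C)` and `φ(Fd ∩ A) ν(C) ≤ q φ(Fd ∩ A ∩ C)`, `ν` the one-block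
  measure of the edges off `T` with `Rv ∪ B` wired;
* `rcMeasure_real_datumOffT_insideCond_eq` — (M3' at the datum) the conditional inside probability
  `φ(Fd ∩ A) / φ(Fd)` is the same for two graphs with the same edges touching `S` and wired sets off
  `S` (cross-multiplied, no division);
* `rcMeasure_real_eq_sum_datumOff_add` — partition of any event by the exploration datum of the
  configuration read on a fixed set of pairs: `φ(A) = Σ_d φ(G_d ∩ A) + φ(A ∩ {rim not wired off In})`.

Everything is proved; no definitions, no named facts.

## References

* [Kesten1986] H. Kesten, *Probab. Theory Related Fields* 73 (1986) 369–394, §2, Lemma (23).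
* [BasuSapozhnikov2017ECP] D. Basu, A. Sapozhnikov, *Electron. Commun. Probab.* 22 (2017) no. 26,
  §2, eq. (2.9).
* G. Grimmett, *The Random-Cluster Model*, Springer (2006): §4.2, Lemma (4.13).
-/

noncomputable section

open MeasureTheory Finset SimpleGraph
open Literature.Probability.Percolation (BondConfig openConnIn explSet explRim explEvent
  mem_explEvent_iff mem_explRim_iff mem_of_mem_explEvent_of_open_edge)

namespace Literature.Probability.LatticeModels

variable {V : Type*} [Fintype V] [DecidableEq V]

/-! ### The hypotheses of the rim-wiring Markov property -/

omit [DecidableEq V] in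
/-- **The off-wired datum event read on the touching edges satisfies the hypotheses of the
rim-wiring Markov property.** With `T` the `G`-edges touching `S` and
`Fd = {ω | ω ∩ T ∈ explEvent In Blk S Rv ∩ {rim wired through S ∖ In}}`: (1) `Fd` is determined by
`ω ∩ T`; (2) an open `T`-edge of a configuration of `Fd` leaves `S` only into `Rv`; (3) any two
vertices of `Rv` are joined in `⟨ω ∩ T⟩` (two attaching edges and an open path inside `S ∖ In`).
[cite: Kesten1986, proof of Thm. 3, eqs. (16)–(19)] -/
theorem datumOffT_rimHyps (G : SimpleGraph V) [DecidableRel G.Adj] (In Blk S Rv : Set V)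
    (T : Finset (Sym2 V)) (hT : ∀ e, e ∈ T ↔ e ∈ G.edgeFinset ∧ ∃ v ∈ S, v ∈ e) :
    let Fd : Set (BondConfig V) := {ω | ω ∩ (↑T : Set (Sym2 V)) ∈ explEvent In Blk S Rv ∩
      {ω | ∀ r ∈ Rv, ∀ r₂ ∈ Rv, ∃ v ∈ S \ In, ∃ v' ∈ S \ In,
        s(v, r) ∈ ω ∧ s(v', r₂) ∈ ω ∧ ω ∈ openConnIn (S \ In) v v'}}
    (∀ ω₁ ω₂ : BondConfig V, ω₁ ∩ ↑T = ω₂ ∩ ↑T → (ω₁ ∈ Fd ↔ ω₂ ∈ Fd)) ∧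
      (∀ ω ∈ Fd, ∀ e ∈ ω, e ∈ T → ∀ x ∈ e, x ∉ S → x ∈ Rv) ∧
      (∀ ω ∈ Fd, ∀ x ∈ Rv, ∀ y ∈ Rv, (fromEdgeSet (ω ∩ ↑T)).Reachable x y) := by
  intro Fd
  refine ⟨fun ω₁ ω₂ h => ?_, fun ω hω e he heT x hxe hxS => ?_, fun ω hω x hx y hy => ?_⟩
  · simp only [Fd, Set.mem_setOf_eq, h]
  · obtain ⟨-, v, hv, hve⟩ := (hT e).1 heT
    have hvx : v ≠ x := fun h => hxS (h ▸ hv)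
    obtain rfl : e = s(v, x) := (Sym2.mem_and_mem_iff hvx).1 ⟨hve, hxe⟩
    exact mem_of_mem_explEvent_of_open_edge hω.1 hv ⟨he, Finset.mem_coe.2 heT⟩ hxS
  · obtain ⟨hωE, hωW⟩ := hω
    obtain ⟨v, hv, v', hv', hvx, hv'y, hvv'⟩ := hωW x hx y hy
    have hdisj : ∀ {a b : V}, a ∈ S → b ∈ Rv → a ≠ b := by
      obtain ⟨h1, h2⟩ := mem_explEvent_iff.1 hωE
      rintro a b ha hb rfl
      rw [← h1] at ha
      rw [← h2] at hb
      exact (mem_explRim_iff.1 hb).1 ha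
    have hadj : ∀ {a b : V}, a ∈ S → b ∈ Rv → s(a, b) ∈ ω ∩ (↑T : Set (Sym2 V)) →
        (fromEdgeSet (ω ∩ (↑T : Set (Sym2 V)))).Adj a b := fun ha hb hab => by
      rw [fromEdgeSet_adj]
      exact ⟨hab, hdisj ha hb⟩
    obtain ⟨p, -⟩ := Percolation.BlockExploration.exists_openWalk_of_mem_openConnIn hvv'
    exact (hadj hv.1 hx hvx).symm.reachable.trans (p.reachable.trans (hadj hv'.1 hy hv'y).reachable)

/-! ### (M4) The outside given the datum: two-block bounds -/

/-- **(M4 at an off-wired datum).** Let `T` be the `G`-edges touching `S`, `B` a wired set off `S`,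
`Fd = {ω | ω ∩ T ∈ explEvent In Blk S Rv ∩ {rim wired through S ∖ In}}`, `A` an event read on `T`
and `C` an event read off `T`. Then for `φ = φ^B_{G,p,q}` (`q ≥ 1`) and the one-block measure
`ν = φ^{Rv ∪ B}_{⟨E(G) ∖ T⟩}`: `φ(Fd ∩ A ∩ C) ≤ q φ(Fd ∩ A) ν(C)` and
`φ(Fd ∩ A) ν(C) ≤ q φ(Fd ∩ A ∩ C)` — the context event `Fd ∩ A` satisfies the hypotheses of
`rcMeasure_real_outside_cond_two_block_bounds` (an empty datum event makes both sides vanish).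
[cite: BasuSapozhnikov2017ECP, §2 eq. (2.9)] -/
theorem rcMeasure_real_datumOffT_two_block_bounds (G : SimpleGraph V) [DecidableRel G.Adj]
    {p q : ℝ} (hp : p ∈ Set.Icc (0 : ℝ) 1) (hq : 1 ≤ q) (B In Blk S Rv : Set V)
    (hBS : ∀ b ∈ B, b ∉ S) (T : Finset (Sym2 V))
    (hT : ∀ e, e ∈ T ↔ e ∈ G.edgeFinset ∧ ∃ v ∈ S, v ∈ e)
    (A : Set (BondConfig V))
    (hA : ∀ ω₁ ω₂ : BondConfig V, ω₁ ∩ ↑T = ω₂ ∩ ↑T → (ω₁ ∈ A ↔ ω₂ ∈ A))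
    (C : Set (BondConfig V))
    (hC : ∀ ω₁ ω₂ : BondConfig V,
      ω₁ ∩ (↑(G.edgeFinset \ T)) = ω₂ ∩ (↑(G.edgeFinset \ T)) → (ω₁ ∈ C ↔ ω₂ ∈ C)) :
    let Fd : Set (BondConfig V) := {ω | ω ∩ (↑T : Set (Sym2 V)) ∈ explEvent In Blk S Rv ∩
      {ω | ∀ r ∈ Rv, ∀ r₂ ∈ Rv, ∃ v ∈ S \ In, ∃ v' ∈ S \ In,
        s(v, r) ∈ ω ∧ s(v', r₂) ∈ ω ∧ ω ∈ openConnIn (S \ In) v v'}}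
    let ν := rcMeasure (fromEdgeSet (↑(G.edgeFinset \ T) : Set (Sym2 V))) p q (Rv ∪ B)
    (rcMeasure G p q B).real (Fd ∩ A ∩ C) ≤ q * (rcMeasure G p q B).real (Fd ∩ A) * ν.real C ∧
      (rcMeasure G p q B).real (Fd ∩ A) * ν.real C ≤
        q * (rcMeasure G p q B).real (Fd ∩ A ∩ C) := by
  intro Fd ν
  have hq0 : 0 < q := one_pos.trans_le hq
  haveI := isProbabilityMeasure_rcMeasure G hp hq0 B
  by_cases hne : Fd.Nonempty
  swap
  · have h0 : Fd = ∅ := Set.not_nonempty_iff_eq_empty.1 hne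
    simp only [h0, Set.empty_inter, measureReal_empty, mul_zero, zero_mul, le_refl, and_self]
  -- the rim misses the explored set (read off a configuration of the datum event)
  obtain ⟨ω₀, hω₀⟩ := hne
  have hRS : ∀ r ∈ Rv, r ∉ S := by
    obtain ⟨h1, h2⟩ := mem_explEvent_iff.1 hω₀.1
    intro r hr hrS
    rw [← h1] at hrS
    rw [← h2] at hr
    exact (mem_explRim_iff.1 hr).1 hrS
  obtain ⟨hFdet, hFrim, hFwire⟩ := datumOffT_rimHyps G In Blk S Rv T hT
  exact rcMeasure_real_outside_cond_two_block_bounds G hp hq B S Rv T hT hRS hBS (Fd ∩ A)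
    (fun ω₁ ω₂ h => and_congr (hFdet ω₁ ω₂ h) (hA ω₁ ω₂ h))
    (fun ω hω => hFrim ω hω.1) (fun ω hω => hFwire ω hω.1) C hC

/-! ### (M3') The inside given the datum does not depend on the outside -/

/-- **(M3' at an off-wired datum).** For two graphs `G₁, G₂` on `V` with the same set `T` of edges
touching `S`, wired sets `B₁, B₂` off `S`, the off-wired datum event
`Fd = {ω | ω ∩ T ∈ explEvent In Blk S Rv ∩ {rim wired through S ∖ In}}` and an inside event `A`
read on `T`: `φ^{B₁}_{G₁}(Fd ∩ A) · φ^{B₂}_{G₂}(Fd) = φ^{B₂}_{G₂}(Fd ∩ A) · φ^{B₁}_{G₁}(Fd)`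
(`0 ≤ p ≤ 1`, `q > 0`). [cite: BasuSapozhnikov2017ECP, §2 eq. (2.9)] -/
theorem rcMeasure_real_datumOffT_insideCond_eq (G₁ G₂ : SimpleGraph V) [DecidableRel G₁.Adj]
    [DecidableRel G₂.Adj] {p q : ℝ} (hp : p ∈ Set.Icc (0 : ℝ) 1) (hq : 0 < q)
    (B₁ B₂ In Blk S Rv : Set V) (hB₁ : ∀ b ∈ B₁, b ∉ S) (hB₂ : ∀ b ∈ B₂, b ∉ S)
    (T : Finset (Sym2 V)) (hT₁ : ∀ e, e ∈ T ↔ e ∈ G₁.edgeFinset ∧ ∃ v ∈ S, v ∈ e)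
    (hT₂ : ∀ e, e ∈ T ↔ e ∈ G₂.edgeFinset ∧ ∃ v ∈ S, v ∈ e) (A : Set (BondConfig V))
    (hA : ∀ ω₁ ω₂ : BondConfig V, ω₁ ∩ ↑T = ω₂ ∩ ↑T → (ω₁ ∈ A ↔ ω₂ ∈ A)) :
    let Fd : Set (BondConfig V) := {ω | ω ∩ (↑T : Set (Sym2 V)) ∈ explEvent In Blk S Rv ∩
      {ω | ∀ r ∈ Rv, ∀ r₂ ∈ Rv, ∃ v ∈ S \ In, ∃ v' ∈ S \ In,
        s(v, r) ∈ ω ∧ s(v', r₂) ∈ ω ∧ ω ∈ openConnIn (S \ In) v v'}}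
    (rcMeasure G₁ p q B₁).real (Fd ∩ A) * (rcMeasure G₂ p q B₂).real Fd =
      (rcMeasure G₂ p q B₂).real (Fd ∩ A) * (rcMeasure G₁ p q B₁).real Fd := by
  intro Fd
  haveI := isProbabilityMeasure_rcMeasure G₁ hp hq B₁
  haveI := isProbabilityMeasure_rcMeasure G₂ hp hq B₂
  by_cases hne : Fd.Nonempty
  swap
  · have h0 : Fd = ∅ := Set.not_nonempty_iff_eq_empty.1 hne
    simp only [h0, Set.empty_inter, measureReal_empty, mul_zero]
  obtain ⟨ω₀, hω₀⟩ := hne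
  have hRS : ∀ r ∈ Rv, r ∉ S := by
    obtain ⟨h1, h2⟩ := mem_explEvent_iff.1 hω₀.1
    intro r hr hrS
    rw [← h1] at hrS
    rw [← h2] at hr
    exact (mem_explRim_iff.1 hr).1 hrS
  obtain ⟨hFdet, hFrim, hFwire⟩ := datumOffT_rimHyps G₁ In Blk S Rv T hT₁
  exact rcMeasure_real_inside_cond_eq_of_rim_wired G₁ G₂ hp hq B₁ B₂ S Rv T hT₁ hT₂ hRS hB₁ hB₂ Fd
    hFdet hFrim hFwire A hA

/-! ### Partition by the exploration datum -/

omit [Fintype V] [DecidableEq V] in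
/-- Membership in the off-wired datum event read on a set of pairs `Rd`, in terms of the
exploration data of the restricted configuration. [cite: BasuSapozhnikov2017ECP, §2 eq. (2.4)] -/
theorem mem_datumOff_iff {Rd : Set (Sym2 V)} {In Blk U R : Set V} {ω : BondConfig V} :
    ω ∈ {ω : BondConfig V | ω ∩ Rd ∈ explEvent In Blk U R ∩
        {ω | ∀ r ∈ R, ∀ r₂ ∈ R, ∃ v ∈ U \ In, ∃ v' ∈ U \ In,
          s(v, r) ∈ ω ∧ s(v', r₂) ∈ ω ∧ ω ∈ openConnIn (U \ In) v v'}} ↔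
      explSet In Blk (ω ∩ Rd) = U ∧ explRim In Blk (ω ∩ Rd) = R ∧
        ∀ r ∈ explRim In Blk (ω ∩ Rd), ∀ r₂ ∈ explRim In Blk (ω ∩ Rd),
          ∃ v ∈ explSet In Blk (ω ∩ Rd) \ In, ∃ v' ∈ explSet In Blk (ω ∩ Rd) \ In,
            s(v, r) ∈ ω ∩ Rd ∧ s(v', r₂) ∈ ω ∩ Rd ∧
              ω ∩ Rd ∈ openConnIn (explSet In Blk (ω ∩ Rd) \ In) v v' := by
  constructor
  · rintro ⟨⟨hU, hR⟩, hw⟩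
    subst hU hR
    exact ⟨rfl, rfl, hw⟩
  · rintro ⟨rfl, rfl, hw⟩
    exact ⟨⟨rfl, rfl⟩, hw⟩

/-- Splitting of indicator masses: if `PS ↔ PW` then `[PA] = [PS ∧ PA] + [PA ∧ ¬ PW]`.
[folklore] -/
theorem ite_datum_split {c : ℝ} {PA PS PW : Prop} {_ : Decidable PA}
    {_ : Decidable (PS ∧ PA)} {_ : Decidable (PA ∧ ¬ PW)} (h : PS ↔ PW) :
    (if PA then c else 0) = (if PS ∧ PA then c else 0) + (if PA ∧ ¬ PW then c else 0) := by
  by_cases hA : PA <;> by_cases hW : PW <;> simp [hA, hW, h]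

/-- **Partition of an event by the exploration datum** (Basu–Sapozhnikov 2017, §2, eq. (2.4):
`F = ⋃ F(U, R)`, disjoint union). For the random-cluster measure `φ = φ^B_{G,p,q}` of a finite graph
and any set of pairs `Rd` on which the configuration is read:
`φ(A) = Σ_{d = (U, R)} φ(G_d ∩ A) + φ(A ∩ {rim not wired off In})`, where
`G_d = {ω | ω ∩ Rd ∈ explEvent In Blk U R ∩ {rim wired through U ∖ In}}` — every configuration lies
in the datum event of its own `(𝒞, 𝒟)` and in no other, and in the wired one iff its rim is wired
through `𝒞 ∖ In`; the measure is a finite sum of point masses. [cite: BasuSapozhnikov2017ECP, §2 eq. (2.4)] -/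
theorem rcMeasure_real_eq_sum_datumOff_add (G : SimpleGraph V) [DecidableRel G.Adj] {p q : ℝ}
    (hp : p ∈ Set.Icc (0 : ℝ) 1) (hq : 0 < q) (B : Set V) (Rd : Set (Sym2 V)) (In Blk : Set V)
    (A : Set (BondConfig V)) :
    (rcMeasure G p q B).real A =
      (∑ d ∈ (Finset.univ : Finset (Finset V × Finset V)),
        (rcMeasure G p q B).real
          ({ω | ω ∩ Rd ∈ explEvent In Blk (↑d.1 : Set V) (↑d.2 : Set V) ∩
            {ω | ∀ r ∈ (↑d.2 : Set V), ∀ r₂ ∈ (↑d.2 : Set V), ∃ v ∈ (↑d.1 : Set V) \ In,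
              ∃ v' ∈ (↑d.1 : Set V) \ In, s(v, r) ∈ ω ∧ s(v', r₂) ∈ ω ∧
                ω ∈ openConnIn ((↑d.1 : Set V) \ In) v v'}} ∩ A)) +
        (rcMeasure G p q B).real
          (A ∩ {ω | ¬ (∀ r ∈ explRim In Blk (ω ∩ Rd), ∀ r₂ ∈ explRim In Blk (ω ∩ Rd),
            ∃ v ∈ explSet In Blk (ω ∩ Rd) \ In, ∃ v' ∈ explSet In Blk (ω ∩ Rd) \ In,
              s(v, r) ∈ ω ∩ Rd ∧ s(v', r₂) ∈ ω ∩ Rd ∧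
                ω ∩ Rd ∈ openConnIn (explSet In Blk (ω ∩ Rd) \ In) v v')}) := by
  classical
  simp only [rcMeasure_real_apply G hp hq B]
  rw [Finset.sum_comm, ← Finset.sum_add_distrib]
  refine Finset.sum_congr rfl fun η _ => ?_
  -- the datum of the configuration `↑η`
  obtain ⟨d₀, hd₁, hd₂⟩ : ∃ d₀ : Finset V × Finset V,
      (↑d₀.1 : Set V) = explSet In Blk ((↑η : BondConfig V) ∩ Rd) ∧
        (↑d₀.2 : Set V) = explRim In Blk ((↑η : BondConfig V) ∩ Rd) :=
    ⟨((Set.toFinite _).toFinset, (Set.toFinite _).toFinset), Set.Finite.coe_toFinset _,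
      Set.Finite.coe_toFinset _⟩
  rw [Finset.sum_eq_single d₀]
  · exact ite_datum_split
      (mem_datumOff_iff.trans ⟨fun h => h.2.2, fun hW => ⟨hd₁.symm, hd₂.symm, hW⟩⟩)
  · intro d _ hne
    refine if_neg fun hd => hne ?_
    obtain ⟨h1, h2, -⟩ := mem_datumOff_iff.1 hd.1
    exact Prod.ext (Finset.coe_inj.1 (h1.symm.trans hd₁.symm))
      (Finset.coe_inj.1 (h2.symm.trans hd₂.symm))
  · exact fun h => absurd (Finset.mem_univ _) h

end Literature.Probability.LatticeModels

end
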